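import Literature.AlgebraicGeometry.CossartJannsenSaito2020.NearPointDirectrix
import Literature.AlgebraicGeometry.CossartJannsenSaito2020.NearPointsDirectrix
import Literature.AlgebraicGeometry.Resolution.BlowupsProperProofs
import Mathlib.AlgebraicGeometry.Morphisms.Proper
import HarnessLib

/-!
# CJS 2020 Thm. 3.14 — equivalence of the two typings in the tree
# (`CossartJannsenSaito2020_thm_3_14`, `NearPointDirectrix.lean` ↔ `Theorem314_dim_lt_dirDim`, `NearPointsDirectrix.lean`)

Topic: `Literature/AlgebraicGeometry/CossartJannsenSaito2020`. The numerical rendering «`dim 𝒪_{D,x} < e_x(X)` at a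
near point of a permissible blow-up, under (F1)» of Cossart–Jannsen–Saito, LNM 2270, Thm. 3.14 (Hironaka–Mizutani)
was typed twice within minutes on 2026-08-27 (cell res-hironaka, crux chain w42): `CossartJannsenSaito2020_thm_3_14`
(p499700) and `Theorem314_dim_lt_dirDim` (p500316, consumed by
`Summits/…/HilbertSamuelEliminationSigmaMaxModificationsCorridor3WLadderGradeZero.lean`). The statements differ only
in binder order and in an extra instance hypothesis `[IsLocallyNoetherian X']` in the second, which is automatic for
a blow-up of a locally noetherian scheme (blow-ups are proper — `IsBlowup.isProper`, Stacks 02NS, proved in the tree —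
hence locally of finite type). This file PROVES the equivalence, so that either name can serve as the binder of a
conditional theorem and a discharge of one discharges the other. No new statement, no new fact.

## Sources

* V. Cossart, U. Jannsen, S. Saito, LNM 2270 (2020), Thm. 3.14. [CossartJannsenSaito2020]
* The Stacks Project, Tag 02NS (blow-ups of finite-type ideals are proper). [StacksProject]
-/

noncomputable section

open CategoryTheory AlgebraicGeometry TopologicalSpace
open Literature.AlgebraicGeometry.Resolution

namespace Literature.AlgebraicGeometry.CossartJannsenSaito2020

universe u

/-- `CossartJannsenSaito2020_thm_3_14` implies the sibling typing `Theorem314_dim_lt_dirDim` (instantiate and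
substitute `x = π(x')`). [cite: CossartJannsenSaito2020, Thm. 3.14] -/
theorem theorem314_dim_lt_dirDim_of_thm_3_14 (h : CossartJannsenSaito2020_thm_3_14.{u}) :
    Theorem314_dim_lt_dirDim.{u} := by
  intro X X' _ _ π D N x' x hX hD hπ hN hx hxD hchar hnear
  subst hx
  exact h X X' π D hX hD hπ N hN x' hxD hchar hnear

/-- The sibling typing `Theorem314_dim_lt_dirDim` implies `CossartJannsenSaito2020_thm_3_14`: the blow-up `X'` of the
locally noetherian `X` is locally noetherian (`IsBlowup.isProper`; proper ⇒ locally of finite type ⇒ locally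
noetherian over a locally noetherian base). [cite: CossartJannsenSaito2020, Thm. 3.14] -/
theorem thm_3_14_of_theorem314_dim_lt_dirDim (h : Theorem314_dim_lt_dirDim.{u}) :
    CossartJannsenSaito2020_thm_3_14.{u} := by
  intro X X' _ π D hX hD hπ N hN x' hxD hchar hnear
  haveI : IsProper π := hπ.isProper
  haveI : IsLocallyNoetherian X' := LocallyOfFiniteType.isLocallyNoetherian π
  exact h X X' π D N x' (π.base x') hX hD hπ hN rfl hxD hchar hnear

/-- **The two typings of CJS Thm. 3.14 in the tree are equivalent.** [cite: CossartJannsenSaito2020, Thm. 3.14] -/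
theorem thm_3_14_iff_theorem314_dim_lt_dirDim :
    CossartJannsenSaito2020_thm_3_14.{u} ↔ Theorem314_dim_lt_dirDim.{u} :=
  ⟨theorem314_dim_lt_dirDim_of_thm_3_14, thm_3_14_of_theorem314_dim_lt_dirDim⟩

end Literature.AlgebraicGeometry.CossartJannsenSaito2020

end
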